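import Summits.CriticalPhenomena.PercolationContinuityZ3.Theorems.PercNearOneGluingNoHeavyQuantGatedSliceMixLawQRoutingLow
import Summits.CriticalPhenomena.PercolationContinuityZ3.Theorems.PercNearOneGluingNoHeavyQuantGatedSliceMixLawQKIneq
import Summits.CriticalPhenomena.PercolationContinuityZ3.Theorems.PercNearOneGluingNoHeavyQuantLawDecUsageMonge
import HarnessLib

/-!
# QUANT lane R8, T-DEC, leg (III), blob case — `LawDec.GatedSliceMixLaw'`, Q-ALONE side: cell QK (the top `k₂` a `t`-low), part A —
# the top SATURATES the twin, or the top fits and the low `k₁` rides the giant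

builds on p205010 (kernel theorem, internal audit signed; external expert review pending)

Support file (`--supports stmt-CriticalPhenomena-4575`), QUANT lane seat prim-quant-arm-1 (gen 41), rung R8 of `run/shared/lean/prim/quant/LADDER.md`.
Theorems only, standard axioms, no sorries, no definitions.  Uses `…QRoutingLow` (`mixLawQ_decAtT_of_routing_low`, `…_of_lowsAbsorb`) and the
scalar lemmas of `…QKIneq`.  Setting (cell QK): frame of the node; `k₁ ≤ j` with `2k₁ < t` (`k₁ = 0` allowed), twin `P = k₁ + a ≤ j` with
`t ≤ 2P`, top `K = k₂ ≤ j` with `2K < t`, `G = k₂ + a ≥ j+1`.  `Q = z·δ₀ + A·δ_{k₁} + B·δ_P + C·δ_K + D·δ_G`.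
* **`mixLawQ_decAtT_qk_topSat`** — `B ≤ usage(K,P)·C` (the top can fill the twin): ship `cap = B/usage(K,P)` of `K` into `P`, the rest of `K`,
  all of `k₁` and the zero into the giant; the giant suffices by `qk_Ic_heavy` / `qk_Ic_light`.
* **`mixLawQ_decAtT_qk_topFits`** — `usage(K,P)·C ≤ B` and (`k₁ = 0` or `P ≤ t`): ship all of `K` into `P`; if `k₁ = 0` nothing else is low
  (`…_of_lowsAbsorb`); if `P ≤ t` ship `k₁` to the giant, which suffices by `qk_Ix`.
EXACT CENSUS (`work/explore/qQK*.py`): these two theorems cover the classes `Zm`, `ZM`, `Lm` of cell QK and the saturated part of `LM`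
(25 579 instances / 0 failures overall); the unsaturated part of `LM` (twin above `t`, `k₁ ≥ 1`) is part B (`…QKCellsB`).
HONEST STATUS: `GatedSliceMixLaw'` (regime R), CW, `GateMove`, `GatedConvEmptyFree`, `SingleGateConvClosed`, `TreeDEC`, `FarTreeRow` OPEN; RATE unchanged.

[this work]; node: prim-quant-stmt g29/g30 (this lane).  Nothing here is cited as a published result.  The gluing rows served
[cite: KozmaNitzan2024, Conjecture 3 (p. 15)]; product measure [cite: Grimmett1999, §1.3 p. 10].
-/

noncomputable section

namespace Summit.CriticalPhenomena.PercolationContinuityZ3.Theorems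

namespace Quant

open Finset

/-- the two-point law `{lo, hi; g}` (as in `…QuantLawDEC`) -/
local notation3 "TP[" lo ", " hi ", " g ", " h "]" =>
  (g : ℝ) * (if (h : ℕ) = (hi : ℕ) then (1 : ℝ) else 0) + (1 - (g : ℝ)) * (if (h : ℕ) = (lo : ℕ) then (1 : ℝ) else 0)

namespace LawDec

set_option maxHeartbeats 800000 in
/-- **CELL QK, THE TOP SATURATES THE TWIN ⟹ `Q` IS DEC.**  See the file header. [this work] -/
theorem mixLawQ_decAtT_qk_topSat (y z g S lam : ℝ) (a j M k₁ k₂ : ℕ)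
    (hy0 : 0 < y) (hy1 : y < 1) (hz0 : 0 ≤ z) (hz1 : z < 1) (hg1 : g ≤ 1) (hyg : y ≤ (1 - z) * g) (ha : 1 ≤ a)
    (hta : y * (M : ℝ) ≤ S) (hk : k₁ ≤ k₂) (hk₂M : k₂ ≤ M) (hlam0 : 0 ≤ lam) (hlam1 : lam ≤ 1)
    (hmean : (1 - z) * ((k₁ : ℝ) + ((k₂ : ℝ) - k₁) * lam) = S)
    (hk₁j : k₁ ≤ j) (hk₁low : 2 * (k₁ : ℝ) < S + (a : ℝ) * g * (1 - z))
    (hPj : k₁ + a ≤ j) (hPmid : S + (a : ℝ) * g * (1 - z) ≤ 2 * ((k₁ + a : ℕ) : ℝ))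
    (hKj : k₂ ≤ j) (hKlow : 2 * (k₂ : ℝ) < S + (a : ℝ) * g * (1 - z)) (hG : j + 1 ≤ k₂ + a)
    (hsat : (1 - z) * (1 - lam) * g ≤ usage y (S + (a : ℝ) * g * (1 - z)) j k₂ (k₁ + a) * ((1 - z) * lam * (1 - g))) :
    DECAtT y (S + (a : ℝ) * g * (1 - z)) j (M + a)
      (fun p => z * (if p = 0 then (1 : ℝ) else 0) + (1 - z) * slice (fun q => TP[k₁, k₂, lam, q]) a g p) := by
  set t : ℝ := S + (a : ℝ) * g * (1 - z) with ht
  set A : ℝ := (1 - z) * (1 - lam) * (1 - g) with hA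
  set B : ℝ := (1 - z) * (1 - lam) * g with hB
  set C : ℝ := (1 - z) * lam * (1 - g) with hC
  set D : ℝ := (1 - z) * lam * g with hD
  have hg0 : 0 < g := by
    by_contra hc
    have : (1 - z) * g ≤ 0 := mul_nonpos_of_nonneg_of_nonpos (by linarith) (not_lt.1 hc)
    linarith
  have h1z : 0 < 1 - z := by linarith
  have h1y : 0 < 1 - y := by linarith
  have hA0 : 0 ≤ A := mul_nonneg (mul_nonneg h1z.le (by linarith)) (by linarith)
  have hB0 : 0 ≤ B := mul_nonneg (mul_nonneg h1z.le (by linarith)) hg0.le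
  have hC0 : 0 ≤ C := mul_nonneg (mul_nonneg h1z.le hlam0) (by linarith)
  have hD0 : 0 ≤ D := mul_nonneg (mul_nonneg h1z.le hlam0) hg0.le
  have hkr : (k₁ : ℝ) ≤ k₂ := by exact_mod_cast hk
  have hk₁0 : (0 : ℝ) ≤ k₁ := Nat.cast_nonneg k₁
  have ht0 : 0 < t := by linarith
  have hPr : ((k₁ + a : ℕ) : ℝ) = (k₁ : ℝ) + a := by push_cast; ring
  have hPng : ¬ (j + 1 ≤ k₁ + a) := by omega
  have huG : usage y t j k₂ (k₂ + a) = y / (1 - y) := usage_giant_eq y t j k₂ (k₂ + a) hG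
  have huG₁ : usage y t j k₁ (k₂ + a) = y / (1 - y) := usage_giant_eq y t j k₁ (k₂ + a) hG
  -- the pair (K, P): `ρ₂ = W₂/d₂`, `0 < ρ₂ < 1`
  set W₂ : ℝ := t - 2 * (k₂ : ℝ) with hW₂
  set d₂ : ℝ := ((k₁ + a : ℕ) : ℝ) - (k₂ : ℝ) with hd₂
  have hW₂0 : 0 < W₂ := by rw [hW₂]; linarith
  have hKP : (k₂ : ℝ) < ((k₁ + a : ℕ) : ℝ) := by linarith
  have hd₂0 : 0 < d₂ := by rw [hd₂]; linarith
  -- `t < K + P` (strict): `S ≤ k₂`, `ag(1−z) ≤ a`, and `2K < t` rules out equality when `k₁ = 0`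
  have hS : S ≤ (k₂ : ℝ) := by
    rw [← hmean]
    have hd0 : 0 ≤ (k₂ : ℝ) - k₁ := by linarith
    have h3 : ((k₂ : ℝ) - k₁) * lam ≤ (k₂ : ℝ) - k₁ := mul_le_of_le_one_right hd0 hlam1
    have h0 : 0 ≤ (k₁ : ℝ) + ((k₂ : ℝ) - k₁) * lam := by nlinarith [mul_nonneg hd0 hlam0]
    calc (1 - z) * ((k₁ : ℝ) + ((k₂ : ℝ) - k₁) * lam) ≤ 1 * ((k₁ : ℝ) + ((k₂ : ℝ) - k₁) * lam) :=
          mul_le_mul_of_nonneg_right (by linarith) h0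
      _ ≤ k₂ := by linarith
  have hagz : (a : ℝ) * g * (1 - z) ≤ a := by
    have ha0 : (0 : ℝ) ≤ a := Nat.cast_nonneg a
    have h5 : g * (1 - z) ≤ 1 := by nlinarith
    nlinarith
  -- the degenerate corner `t ≥ K + P` (only `k₁ = 0`, `g = 1`: then `C = 0` and nothing nonzero is low)
  by_cases hKcomp : ¬ (t < (k₂ : ℝ) + ((k₁ + a : ℕ) : ℝ))
  · have hle : (k₂ : ℝ) + ((k₁ + a : ℕ) : ℝ) ≤ t := not_lt.1 hKcomp
    rw [hPr] at hle
    have hk₁z : k₁ = 0 := by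
      by_contra hne
      have : (1 : ℝ) ≤ k₁ := by exact_mod_cast Nat.one_le_iff_ne_zero.2 hne
      linarith
    subst hk₁z
    have hg1' : g = 1 := by
      by_contra hne
      have hg' : g < 1 := lt_of_le_of_ne hg1 hne
      have ha0 : (0 : ℝ) < a := by exact_mod_cast (Nat.lt_of_lt_of_le Nat.zero_lt_one ha)
      have h3 : g * (1 - z) ≤ g := mul_le_of_le_one_right hg0.le (by linarith)
      have h4 : (a : ℝ) * (g * (1 - z)) < (a : ℝ) * 1 := mul_lt_mul_of_pos_left (by linarith) ha0
      have : (a : ℝ) * g * (1 - z) < a := by linarith [h4, mul_assoc (a : ℝ) g (1 - z)]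
      push_cast at hle; linarith
    refine mixLawQ_decAtT_of_lowsAbsorb y z g S lam a j M 0 k₂ hy0 hy1 hz0 hz1 hg1 hyg ha hta hk hk₂M hlam0 hlam1 hmean hk₁j hk₁low
      hPj hPmid hKj hKlow hG (fun h => absurd h (by omega)) ?_
    rw [if_neg (by omega), mul_zero, mul_zero, zero_add, hg1', sub_self, mul_zero, mul_zero]
    exact mul_nonneg (mul_nonneg h1z.le (by linarith)) zero_le_one
  have hKcomp' : t < (k₂ : ℝ) + ((k₁ + a : ℕ) : ℝ) := not_not.1 hKcomp
  have hWd : W₂ < d₂ := by rw [hW₂, hd₂]; linarith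
  set ρ₂ : ℝ := W₂ / d₂ with hρ₂
  have hρ0 : 0 < ρ₂ := div_pos hW₂0 hd₂0
  have hρ1 : ρ₂ < 1 := by rw [hρ₂, div_lt_one hd₂0]; exact hWd
  -- top-affordability of the giant and of `K`
  have hyK : y * (k₂ : ℝ) ≤ S := (mul_le_mul_of_nonneg_left (by exact_mod_cast hk₂M) hy0.le).trans hta
  -- the final inequality `y(z + A + C − cap) ≤ (1−y)D`, in both rate regimes, gives the routing
  have main : ∀ cap : ℝ, 0 ≤ cap → cap ≤ C → usage y t j k₂ (k₁ + a) * cap = B →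
      y * (z + A + C - cap) ≤ (1 - y) * D →
      DECAtT y t j (M + a) (fun p => z * (if p = 0 then (1 : ℝ) else 0) + (1 - z) * slice (fun q => TP[k₁, k₂, lam, q]) a g p) := by
    intro cap hcap0 hcapC hsatK hE
    set x₁G : ℝ := A * (if 1 ≤ k₁ then (1 : ℝ) else 0) with hx₁G
    have hx₁G0 : 0 ≤ x₁G := mul_nonneg hA0 (by split_ifs <;> norm_num)
    have hx₁GA : x₁G ≤ A := by rw [hx₁G]; split_ifs <;> nlinarith
    have hcapG : usage y t j k₁ (k₂ + a) * x₁G + usage y t j k₂ (k₂ + a) * (C - cap) ≤ D := by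
      rw [huG, huG₁, ← mul_add, div_mul_eq_mul_div, div_le_iff₀ h1y]
      nlinarith [mul_nonneg hy0.le hz0]
    refine mixLawQ_decAtT_of_routing_low y z g S lam a j M k₁ k₂ 0 x₁G cap (C - cap) hy0 hy1 hz0 hz1 hg1 hyg ha hta hk hk₂M
      hlam0 hlam1 hmean hk₁j hk₁low hPj hPmid hKj hKlow hG le_rfl hx₁G0 hcap0 (by linarith) (fun h1 => by
        rw [hx₁G, if_pos h1]; ring) (fun h0 => ⟨rfl, by rw [hx₁G, if_neg (by omega)]; ring⟩) (by ring)
      (fun h => absurd h (lt_irrefl _)) (by rw [mul_zero, zero_add]; exact le_of_eq hsatK) hcapG ?_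
    -- the offer: the twin is exactly full, the giant's leftover absorbs the zero
    rw [mul_zero, zero_add, hsatK, sub_self, mul_zero, zero_add, huG, huG₁, ← mul_add]
    have hz : z + (A - 0 - x₁G) ≤ (1 - y) / y * D - (x₁G + (C - cap)) := by
      rw [div_mul_eq_mul_div, le_sub_iff_add_le, le_div_iff₀ hy0]
      have e1 : (z + (A - 0 - x₁G) + (x₁G + (C - cap))) * y = y * (z + A + C - cap) := by ring
      rw [e1]; exact hE
    have e : t * (1 - y) / y * (D - y / (1 - y) * (x₁G + (C - cap))) = t * ((1 - y) / y * D - (x₁G + (C - cap))) := by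
      have hy0' : y ≠ 0 := ne_of_gt hy0
      have h1y' : 1 - y ≠ 0 := ne_of_gt h1y
      field_simp
    rw [e]
    exact mul_le_mul_of_nonneg_left hz ht0.le
  -- the two rate regimes of the pair (K, P)
  by_cases hheavy : y * d₂ ≤ W₂
  · -- heavy: `usage = ρ₂/(1−ρ₂)`, `cap·W₂ = B(d₂ − W₂)`
    have hyρ : y ≤ ρ₂ := by rw [hρ₂, le_div_iff₀ hd₂0]; exact hheavy
    have huK : usage y t j k₂ (k₁ + a) = ρ₂ / (1 - ρ₂) := by
      have hmax : y ^ 2 + (1 - y) * ρ₂ ≤ ρ₂ := by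
        have h := mul_nonpos_of_nonneg_of_nonpos hy0.le (sub_nonpos.2 hyρ)
        have e : y ^ 2 + (1 - y) * ρ₂ = ρ₂ + y * (y - ρ₂) := by ring
        rw [e]; linarith
      simp only [usage, gateOf, if_neg hPng, pairGate]
      rw [← hW₂, ← hd₂, ← hρ₂, max_eq_left hmax]
    set cap : ℝ := B * (1 - ρ₂) / ρ₂ with hcapdef
    have hcap0 : 0 ≤ cap := div_nonneg (mul_nonneg hB0 (by linarith)) hρ0.le
    have hρne : 1 - ρ₂ ≠ 0 := ne_of_gt (by linarith)
    have hρne0 : ρ₂ ≠ 0 := ne_of_gt hρ0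
    have hsatK : usage y t j k₂ (k₁ + a) * cap = B := by
      rw [huK, hcapdef, div_mul_div_comm, mul_comm (1 - ρ₂) ρ₂, ← mul_assoc]
      rw [mul_div_mul_right _ _ hρne, mul_comm ρ₂ B, mul_div_assoc, div_self hρne0, mul_one]
    have hcapC : cap ≤ C := by
      have hU0 : 0 < usage y t j k₂ (k₁ + a) := by rw [huK]; exact div_pos hρ0 (by linarith)
      by_contra hc
      have : usage y t j k₂ (k₁ + a) * C < usage y t j k₂ (k₁ + a) * cap := mul_lt_mul_of_pos_left (not_le.1 hc) hU0
      rw [hsatK] at this; linarith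
    have hcap_eq : cap * W₂ = B * (((k₁ : ℝ) + a - k₂) - W₂) := by
      have hd₂' : d₂ = (k₁ : ℝ) + a - k₂ := by rw [hd₂, hPr]
      have hdne : d₂ ≠ 0 := ne_of_gt hd₂0
      have hWne : W₂ ≠ 0 := ne_of_gt hW₂0
      rw [hcapdef, hρ₂, ← hd₂']
      field_simp
    refine main cap hcap0 hcapC hsatK ?_
    have := qk_Ic_heavy y z g lam S (k₁ : ℝ) (k₂ : ℝ) (a : ℝ) cap hy0 hz0 hg0.le hg1 hlam0 hlam1 hyg hk₁0 hkr hmean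
      (by rw [← hW₂]; exact hW₂0) (by rw [← hW₂]; exact hcap_eq)
    rw [hA, hC, hD]; exact this
  · -- light: `usage = γ/(1−γ)`, `γ = y² + (1−y)ρ₂ ≤ y`, `cap·γ = B(1 − γ)`
    have hlt : W₂ < y * d₂ := not_le.1 hheavy
    have hρy : ρ₂ < y := by rw [hρ₂, div_lt_iff₀ hd₂0]; exact hlt
    set γ : ℝ := y ^ 2 + (1 - y) * ρ₂ with hγ
    have hγ0 : 0 < γ := by
      have h1 : 0 < (1 - y) * ρ₂ := mul_pos h1y hρ0
      rw [hγ]; nlinarith [sq_nonneg y]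
    have hγy : γ ≤ y := by
      have h1 := mul_le_mul_of_nonneg_left hρy.le h1y.le
      have e : y ^ 2 + (1 - y) * y = y := by ring
      rw [hγ]; linarith
    have hγ1 : γ < 1 := by linarith
    have huK : usage y t j k₂ (k₁ + a) = γ / (1 - γ) := by
      have hmax : ρ₂ ≤ y ^ 2 + (1 - y) * ρ₂ := by
        have h1 := mul_le_mul_of_nonneg_left hρy.le hy0.le
        have e1 : y ^ 2 = y * y := sq y
        have e2 : (1 - y) * ρ₂ = ρ₂ - y * ρ₂ := by ring
        linarith
      simp only [usage, gateOf, if_neg hPng, pairGate]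
      rw [← hW₂, ← hd₂, ← hρ₂, max_eq_right hmax]
    set cap : ℝ := B * (1 - γ) / γ with hcapdef
    have hcap0 : 0 ≤ cap := div_nonneg (mul_nonneg hB0 (by linarith)) hγ0.le
    have hγne : 1 - γ ≠ 0 := ne_of_gt (by linarith)
    have hγne0 : γ ≠ 0 := ne_of_gt hγ0
    have hsatK : usage y t j k₂ (k₁ + a) * cap = B := by
      rw [huK, hcapdef, div_mul_div_comm, mul_comm (1 - γ) γ, ← mul_assoc]
      rw [mul_div_mul_right _ _ hγne, mul_comm γ B, mul_div_assoc, div_self hγne0, mul_one]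
    have hcapC : cap ≤ C := by
      have hU0 : 0 < usage y t j k₂ (k₁ + a) := by rw [huK]; exact div_pos hγ0 (by linarith)
      by_contra hc
      have : usage y t j k₂ (k₁ + a) * C < usage y t j k₂ (k₁ + a) * cap := mul_lt_mul_of_pos_left (not_le.1 hc) hU0
      rw [hsatK] at this; linarith
    have hcap_eq : cap * γ = B * (1 - γ) := by rw [hcapdef]; field_simp
    refine main cap hcap0 hcapC hsatK ?_
    have := qk_Ic_light y z g lam γ cap hy0 hz1.le hg0.le hlam1 hyg hγ0 hγy (by rw [hB] at hcap_eq; exact hcap_eq)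
    rw [hA, hC, hD]; exact this

set_option maxHeartbeats 400000 in
/-- **CELL QK, THE TOP FITS IN THE TWIN AND (`k₁ = 0` OR THE TWIN IS AT OR BELOW `t`) ⟹ `Q` IS DEC.**  See the file header. [this work] -/
theorem mixLawQ_decAtT_qk_topFits (y z g S lam : ℝ) (a j M k₁ k₂ : ℕ)
    (hy0 : 0 < y) (hy1 : y < 1) (hz0 : 0 ≤ z) (hz1 : z < 1) (hg1 : g ≤ 1) (hyg : y ≤ (1 - z) * g) (ha : 1 ≤ a)
    (hta : y * (M : ℝ) ≤ S) (hk : k₁ ≤ k₂) (hk₂M : k₂ ≤ M) (hlam0 : 0 ≤ lam) (hlam1 : lam ≤ 1)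
    (hmean : (1 - z) * ((k₁ : ℝ) + ((k₂ : ℝ) - k₁) * lam) = S)
    (hk₁j : k₁ ≤ j) (hk₁low : 2 * (k₁ : ℝ) < S + (a : ℝ) * g * (1 - z))
    (hPj : k₁ + a ≤ j) (hPmid : S + (a : ℝ) * g * (1 - z) ≤ 2 * ((k₁ + a : ℕ) : ℝ))
    (hKj : k₂ ≤ j) (hKlow : 2 * (k₂ : ℝ) < S + (a : ℝ) * g * (1 - z)) (hG : j + 1 ≤ k₂ + a)
    (hfit : usage y (S + (a : ℝ) * g * (1 - z)) j k₂ (k₁ + a) * ((1 - z) * lam * (1 - g)) ≤ (1 - z) * (1 - lam) * g)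
    (hcase : k₁ = 0 ∨ (k₁ : ℝ) + a ≤ S + (a : ℝ) * g * (1 - z)) :
    DECAtT y (S + (a : ℝ) * g * (1 - z)) j (M + a)
      (fun p => z * (if p = 0 then (1 : ℝ) else 0) + (1 - z) * slice (fun q => TP[k₁, k₂, lam, q]) a g p) := by
  rcases Nat.eq_zero_or_pos k₁ with h0 | hpos
  · -- `k₁ = 0`: the top is the only nonzero low and it fits
    subst h0
    refine mixLawQ_decAtT_of_lowsAbsorb y z g S lam a j M 0 k₂ hy0 hy1 hz0 hz1 hg1 hyg ha hta hk hk₂M hlam0 hlam1 hmean hk₁j hk₁low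
      hPj hPmid hKj hKlow hG (fun h => absurd h (by omega)) ?_
    rw [if_neg (by omega), mul_zero, mul_zero, zero_add]; exact hfit
  · -- `k₁ ≥ 1` and the twin at or below `t`: `K` fills part of `P`, `k₁` and the zero ride the giant (`qk_Ix`)
    have hPt : (k₁ : ℝ) + a ≤ S + (a : ℝ) * g * (1 - z) := by
      rcases hcase with h | h
      · exfalso; omega
      · exact h
    set t : ℝ := S + (a : ℝ) * g * (1 - z) with ht
    set A : ℝ := (1 - z) * (1 - lam) * (1 - g) with hA
    set D : ℝ := (1 - z) * lam * g with hD
    have hg0 : 0 < g := by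
      by_contra hc
      have : (1 - z) * g ≤ 0 := mul_nonpos_of_nonneg_of_nonpos (by linarith) (not_lt.1 hc)
      linarith
    have h1z : 0 < 1 - z := by linarith
    have h1y : 0 < 1 - y := by linarith
    have hA0 : 0 ≤ A := mul_nonneg (mul_nonneg h1z.le (by linarith)) (by linarith)
    have hC0 : 0 ≤ (1 - z) * lam * (1 - g) := mul_nonneg (mul_nonneg h1z.le hlam0) (by linarith)
    have hkr : (k₁ : ℝ) ≤ k₂ := by exact_mod_cast hk
    have hk₁0 : (0 : ℝ) ≤ k₁ := Nat.cast_nonneg k₁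
    have ht0 : 0 < t := by linarith
    have hPr : ((k₁ + a : ℕ) : ℝ) = (k₁ : ℝ) + a := by push_cast; ring
    have huG₁ : usage y t j k₁ (k₂ + a) = y / (1 - y) := usage_giant_eq y t j k₁ (k₂ + a) hG
    have hyK : y * (k₂ : ℝ) ≤ S := (mul_le_mul_of_nonneg_left (by exact_mod_cast hk₂M) hy0.le).trans hta
    -- `k₂ + 1 ≤ a`: `2k₂ < t ≤ k₂ + a`
    have hS : S ≤ (k₂ : ℝ) := by
      rw [← hmean]
      have hd0 : 0 ≤ (k₂ : ℝ) - k₁ := by linarith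
      have h3 : ((k₂ : ℝ) - k₁) * lam ≤ (k₂ : ℝ) - k₁ := mul_le_of_le_one_right hd0 hlam1
      have h0 : 0 ≤ (k₁ : ℝ) + ((k₂ : ℝ) - k₁) * lam := by nlinarith [mul_nonneg hd0 hlam0]
      calc (1 - z) * ((k₁ : ℝ) + ((k₂ : ℝ) - k₁) * lam) ≤ 1 * ((k₁ : ℝ) + ((k₂ : ℝ) - k₁) * lam) :=
            mul_le_mul_of_nonneg_right (by linarith) h0
        _ ≤ k₂ := by linarith
    have hagz : (a : ℝ) * g * (1 - z) ≤ a := by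
      have ha0 : (0 : ℝ) ≤ a := Nat.cast_nonneg a
      have h5 : g * (1 - z) ≤ 1 := by nlinarith
      nlinarith
    have hKa : (k₂ : ℝ) + 1 ≤ a := by
      have h1 : (k₂ : ℝ) < a := by linarith
      have h2 : k₂ < a := by exact_mod_cast h1
      exact_mod_cast (show k₂ + 1 ≤ a by omega)
    have hIx := qk_Ix y z g lam S (k₁ : ℝ) (k₂ : ℝ) (a : ℝ) hz0 hz1 hg0.le hg1 hlam0 hlam1 hyg hk₁0 hkr
      (by have : (1 : ℝ) ≤ k₁ := by exact_mod_cast hpos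
          linarith) hmean hyK hKa hPt
    have hcapG : usage y t j k₁ (k₂ + a) * A + usage y t j k₂ (k₂ + a) * 0 ≤ D := by
      rw [mul_zero, add_zero, huG₁, div_mul_eq_mul_div, div_le_iff₀ h1y]
      rw [hA, hD]; nlinarith [mul_nonneg hy0.le hz0]
    refine mixLawQ_decAtT_of_routing_low y z g S lam a j M k₁ k₂ 0 A ((1 - z) * lam * (1 - g)) 0 hy0 hy1 hz0 hz1 hg1 hyg ha hta
      hk hk₂M hlam0 hlam1 hmean hk₁j hk₁low hPj hPmid hKj hKlow hG le_rfl hA0 hC0 le_rfl (fun _ => by rw [hA]; ring)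
      (fun h0 => absurd h0 (by omega)) (by ring) (fun h => absurd h (lt_irrefl _)) (by rw [mul_zero, zero_add]; exact hfit) hcapG ?_
    -- the offer: the twin is at or below `t` (no credit there), the giant's leftover `D − uA` absorbs the zero
    have hnot : ¬ (t < ((k₁ + a : ℕ) : ℝ)) := by rw [hPr]; exact not_lt.2 hPt
    rw [if_neg hnot, zero_mul, zero_add, mul_zero, add_zero, huG₁]
    have hz' : z + (A - 0 - A) = z := by ring
    rw [hz']
    have e : t * (1 - y) / y * (D - y / (1 - y) * A) = t * ((1 - y) / y * D - A) := by
      have hy0' : y ≠ 0 := ne_of_gt hy0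
      have h1y' : 1 - y ≠ 0 := ne_of_gt h1y
      field_simp
    rw [e]
    refine mul_le_mul_of_nonneg_left ?_ ht0.le
    rw [div_mul_eq_mul_div, le_sub_iff_add_le, le_div_iff₀ hy0]
    rw [hA, hD]; nlinarith [hIx]

end LawDec

end Quant

end Summit.CriticalPhenomena.PercolationContinuityZ3.Theorems
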